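import Summits.AnomalousDissipation.AnomalousDissipation.Theses.WazewskiBlock
import Summits.AnomalousDissipation.AnomalousDissipation.Theorems.WazewskiBlockPlanarGalerkinNoTrapEnstrophy

/-!
# Route `WazewskiBlock`: proof of the support item `PlanarGalerkinNoTrap`
# (stmt-AnomalousDissipation-10356) — the two-dimensional one-way door

`Summit.AnomalousDissipation.AnomalousDissipation.Theses.WazewskiBlock.PlanarGalerkinNoTrap`:
for a planar (`f₂ ≡ 0`), vertically invariant, mean-zero trigonometric-polynomial force `f` on
`𝕋³` and any `E, ε₀ > 0` there is `ν₁ > 0`, INDEPENDENT of the Galerkin order, such that for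
`0 < ν < ν₁` no global Galerkin trajectory of any order `N` whose slices are planar and vertically
invariant satisfies `KE (U t) ≤ E` and `(f, U t) ≥ ε₀` for all `t ≥ 0`. This is Alexakis–Doering
2006, §2 (`ε² ≤ νU³‖Δf‖` in two dimensions) at the Galerkin level, for trapped orbits:

* energy identity ⇒ `ν ∫₀ᵀ ‖∇U‖² ≥ ε₀ T - E`;
* the planar Galerkin enstrophy identity (exact: the truncation commutes with `Δ`, and
  `b(U, U, ΔU) = 0` for planar `x₂`-independent fields) ⇒
  `ν ∫₀ᵀ ‖ΔU‖² ≤ ½‖∇U(0)‖² + T ‖Δf‖ (2E)^{1/2}`, `½‖∇U(0)‖² ≤ 4π²N²E`;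
* interpolation `‖∇U‖² ≤ ‖U‖‖ΔU‖ ≤ (λ/2)‖ΔU‖² + ‖U‖²/(2λ)` with `λ = 2νE/ε₀`;
* hence `ε₀T - E ≤ νE·(4π²N²E)/ε₀ + T·νE‖Δf‖√(2E)/ε₀ + ε₀T/2`, impossible for large `T` as
  soon as `ν (2E√(2E)‖Δf‖ + 1) < ε₀²`.

The calculus is `budget_inequality` (pure real analysis on the five budget functions exported by
`exists_planar_budget_functions`); the closing theorem is `planarGalerkinNoTrap_proof`, with
`ν₁ = ε₀² / (2E'√(2E')L₀ + 1)`, `E' = max E 1`, `L₀² = ∑_{|k|²≤m²} (4π²|k|²)²‖f̂ k‖²`.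

References: A. Alexakis, C. R. Doering, *Energy and enstrophy dissipation in steady state 2d
turbulence*, Phys. Lett. A 359 (2006), §2; C. Foias, O. Manley, R. Rosa, R. Temam,
*Navier–Stokes Equations and Turbulence*, CUP 2001, App. II.A (A.62)–(A.67).
-/

-- `Summit.<Summit>.<Problem>` is the tree's mandated summit-side namespace (CONVENTIONS §2); for this
-- single-conjunct summit the two coincide, so the duplicate is deliberate.
set_option linter.dupNamespace false

noncomputable section

open MeasureTheory Set Filter Topology UnitAddTorus
open scoped InnerProductSpace RealInnerProductSpace

namespace Summit.AnomalousDissipation.AnomalousDissipation.Theorems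

open Literature.Analysis.FunctionSpaces Literature.Analysis.FunctionSpaces.Torus
open Literature.Analysis.FluidPDE
open Summit.AnomalousDissipation.AnomalousDissipation.Theorems.WazewskiBlock.PlanarGalerkinNoTrap

/-! ### The budget inequality (real analysis) -/

/-- **The Alexakis–Doering budget inequality, abstract form.** Let `e, G, Lp, P, Wk` be continuous
real functions (energy, enstrophy, palinstrophy, enstrophy forcing, work) with `e, G ≥ 0`,
`e' = 2(-νG + Wk)` and `G' = 2(-νLp - P)` on `[0, T]` (`ν ≥ 0`), and suppose on `[0, T]`:
`e ≤ 2E`, `Wk ≥ ε₀`, `-P ≤ B`, and `G ≤ (λ/2)Lp + e/(2λ)` (`λ > 0`). Then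
`ε₀T - E ≤ (λ/2)(G(0)/2 + BT) + νET/λ`. Proof: integrate the two identities
(`ν∫G ≥ ε₀T - E`, `ν∫Lp ≤ G(0)/2 + BT`) and the interpolation (`∫G ≤ (λ/2)∫Lp + ET/λ`)
(Alexakis–Doering 2006, §2). [folklore] -/
theorem budget_inequality {ν E ε₀ B lam T : ℝ} {e G Lp P Wk : ℝ → ℝ}
    (hT : 0 ≤ T) (hlam : 0 < lam) (hν : 0 ≤ ν)
    (he_cont : Continuous e) (hG_cont : Continuous G) (hLp_cont : Continuous Lp)
    (hP_cont : Continuous P) (hWk_cont : Continuous Wk)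
    (he0 : ∀ τ, 0 ≤ e τ) (hG0 : ∀ τ, 0 ≤ G τ)
    (he_deriv : ∀ τ ∈ Icc 0 T, HasDerivWithinAt e (2 * (-(ν * G τ) + Wk τ)) (Icc 0 T) τ)
    (hG_deriv : ∀ τ ∈ Icc 0 T, HasDerivWithinAt G (2 * (-(ν * Lp τ) - P τ)) (Icc 0 T) τ)
    (he_le : ∀ τ ∈ Icc 0 T, e τ ≤ 2 * E) (hWk : ∀ τ ∈ Icc 0 T, ε₀ ≤ Wk τ)
    (hP : ∀ τ ∈ Icc 0 T, -P τ ≤ B)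
    (hinterp : ∀ τ, G τ ≤ lam / 2 * Lp τ + e τ / (2 * lam)) :
    ε₀ * T - E ≤ lam / 2 * (G 0 / 2 + B * T) + ν * E * T / lam := by
  -- interval integrability of everything in sight
  have iG : IntervalIntegrable G volume 0 T := hG_cont.intervalIntegrable 0 T
  have ie : IntervalIntegrable e volume 0 T := he_cont.intervalIntegrable 0 T
  have iLp : IntervalIntegrable Lp volume 0 T := hLp_cont.intervalIntegrable 0 T
  have iP : IntervalIntegrable P volume 0 T := hP_cont.intervalIntegrable 0 T
  have iWk : IntervalIntegrable Wk volume 0 T := hWk_cont.intervalIntegrable 0 T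
  have inG : IntervalIntegrable (fun τ => -(ν * G τ)) volume 0 T := (iG.const_mul ν).neg
  have inLp : IntervalIntegrable (fun τ => -(ν * Lp τ)) volume 0 T := (iLp.const_mul ν).neg
  -- FTC for the energy
  have hFTCe : ∫ τ in (0 : ℝ)..T, 2 * (-(ν * G τ) + Wk τ) = e T - e 0 := by
    refine intervalIntegral.integral_eq_sub_of_hasDeriv_right_of_le hT
      he_cont.continuousOn (fun τ hτ => ?_) ((inG.add iWk).const_mul 2)
    exact ((he_deriv τ ⟨hτ.1.le, hτ.2.le⟩).hasDerivAt (Icc_mem_nhds hτ.1 hτ.2)).hasDerivWithinAt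
  have hsplit_e : ∫ τ in (0 : ℝ)..T, 2 * (-(ν * G τ) + Wk τ) =
      2 * (-(ν * ∫ τ in (0 : ℝ)..T, G τ) + ∫ τ in (0 : ℝ)..T, Wk τ) := by
    rw [intervalIntegral.integral_const_mul, intervalIntegral.integral_add inG iWk,
      intervalIntegral.integral_neg, intervalIntegral.integral_const_mul]
  -- FTC for the enstrophy
  have hFTCG : ∫ τ in (0 : ℝ)..T, 2 * (-(ν * Lp τ) - P τ) = G T - G 0 := by
    refine intervalIntegral.integral_eq_sub_of_hasDeriv_right_of_le hT
      hG_cont.continuousOn (fun τ hτ => ?_) ((inLp.sub iP).const_mul 2)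
    exact ((hG_deriv τ ⟨hτ.1.le, hτ.2.le⟩).hasDerivAt (Icc_mem_nhds hτ.1 hτ.2)).hasDerivWithinAt
  have hsplit_G : ∫ τ in (0 : ℝ)..T, 2 * (-(ν * Lp τ) - P τ) =
      2 * (-(ν * ∫ τ in (0 : ℝ)..T, Lp τ) - ∫ τ in (0 : ℝ)..T, P τ) := by
    rw [intervalIntegral.integral_const_mul, intervalIntegral.integral_sub inLp iP,
      intervalIntegral.integral_neg, intervalIntegral.integral_const_mul]
  -- integral bounds
  have hIW : ε₀ * T ≤ ∫ τ in (0 : ℝ)..T, Wk τ := by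
    have h := intervalIntegral.integral_mono_on hT (intervalIntegrable_const (c := ε₀)) iWk hWk
    rwa [intervalIntegral.integral_const, sub_zero, smul_eq_mul, mul_comm] at h
  have hIP : -(∫ τ in (0 : ℝ)..T, P τ) ≤ B * T := by
    have h := intervalIntegral.integral_mono_on hT (f := fun τ => -P τ) iP.neg
      (intervalIntegrable_const (c := B)) hP
    rwa [intervalIntegral.integral_const, sub_zero, smul_eq_mul, mul_comm,
      intervalIntegral.integral_neg] at h
  have hIe : ∫ τ in (0 : ℝ)..T, e τ ≤ 2 * E * T := by
    have h := intervalIntegral.integral_mono_on hT ie (intervalIntegrable_const (c := 2 * E))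
      he_le
    rwa [intervalIntegral.integral_const, sub_zero, smul_eq_mul, mul_comm] at h
  have hIG : ∫ τ in (0 : ℝ)..T, G τ ≤
      lam / 2 * (∫ τ in (0 : ℝ)..T, Lp τ) + (∫ τ in (0 : ℝ)..T, e τ) / (2 * lam) := by
    have h := intervalIntegral.integral_mono_on hT iG ((iLp.const_mul (lam / 2)).add
      (ie.div_const (2 * lam))) fun τ _ => hinterp τ
    rwa [intervalIntegral.integral_add (iLp.const_mul (lam / 2)) (ie.div_const (2 * lam)),
      intervalIntegral.integral_const_mul, intervalIntegral.integral_div] at h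
  -- bookkeeping
  have heT : e T ≤ 2 * E := he_le T ⟨hT, le_rfl⟩
  have he00 : 0 ≤ e 0 := he0 0
  have hGT : 0 ≤ G T := hG0 T
  rw [hsplit_e] at hFTCe
  rw [hsplit_G] at hFTCG
  -- `ν ∫ G ≥ ε₀ T - E` and `ν ∫ Lp ≤ G 0 / 2 + B T`
  have h1 : ε₀ * T - E ≤ ν * ∫ τ in (0 : ℝ)..T, G τ := by linarith
  have h2 : ν * ∫ τ in (0 : ℝ)..T, Lp τ ≤ G 0 / 2 + B * T := by linarith
  -- multiply the interpolation by `ν ≥ 0`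
  have h3 : ν * ∫ τ in (0 : ℝ)..T, G τ ≤
      lam / 2 * (ν * ∫ τ in (0 : ℝ)..T, Lp τ) + ν * (∫ τ in (0 : ℝ)..T, e τ) / (2 * lam) := by
    have h := mul_le_mul_of_nonneg_left hIG hν
    have heq : ν * (lam / 2 * (∫ τ in (0 : ℝ)..T, Lp τ) + (∫ τ in (0 : ℝ)..T, e τ) / (2 * lam)) =
        lam / 2 * (ν * ∫ τ in (0 : ℝ)..T, Lp τ) + ν * (∫ τ in (0 : ℝ)..T, e τ) / (2 * lam) := by
      ring
    linarith
  have h4 : ν * (∫ τ in (0 : ℝ)..T, e τ) / (2 * lam) ≤ ν * E * T / lam := by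
    have h := mul_le_mul_of_nonneg_left hIe hν
    have h' : ν * (∫ τ in (0 : ℝ)..T, e τ) / (2 * lam) ≤ ν * (2 * E * T) / (2 * lam) :=
      div_le_div_of_nonneg_right h (by positivity)
    have heq : ν * (2 * E * T) / (2 * lam) = ν * E * T / lam := by
      rw [div_eq_div_iff (by positivity) (by positivity)]
      ring
    linarith
  have h5 : lam / 2 * (ν * ∫ τ in (0 : ℝ)..T, Lp τ) ≤ lam / 2 * (G 0 / 2 + B * T) :=
    mul_le_mul_of_nonneg_left h2 (by positivity)
  linarith

/-! ### The item -/

/-- **`PlanarGalerkinNoTrap` (item stmt-AnomalousDissipation-10356 of route `WazewskiBlock`).**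
For a planar, vertically invariant, mean-zero vector trigonometric polynomial force `f` of order
`m` on `𝕋³` and any `E`, `ε₀ > 0`, put `E' = max E 1`,
`L₀ = (∑_{|k|²≤m²} (4π²|k|²)² ‖f̂ k‖²)^{1/2}` and `ν₁ = ε₀² / (2E'√(2E') L₀ + 1) > 0`
(independent of the Galerkin order). For `0 < ν < ν₁`, no global field-level Galerkin trajectory
`U` of any order `N` (joint continuity, Galerkin-mode slices, tested Galerkin equations, energy
identity) with planar vertically invariant slices satisfies `KE (U t) ≤ E` and `(f, U t) ≥ ε₀`
for all `t ≥ 0`: by `exists_planar_budget_functions` and `budget_inequality` with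
`λ = 2νE'/ε₀`, every `T ≥ 0` would satisfy `T ≤ 2ε₀E'/ν + E' G(0)`, which fails for
`T = 2ε₀E'/ν + E' G(0) + 1` (Alexakis–Doering 2006, §2, at Galerkin level). [folklore] -/
theorem planarGalerkinNoTrap_proof :
    Summit.AnomalousDissipation.AnomalousDissipation.Theses.WazewskiBlock.PlanarGalerkinNoTrap := by
  intro m f hf _hmean _hfpl _hfinv E ε₀ hε₀
  -- the constants
  set E' : ℝ := max E 1 with hE'
  set L₀ : ℝ := Real.sqrt (∑ k ∈ freqBall m, (4 * Real.pi ^ 2 * freqNormSq k) ^ 2 *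
    ‖mFourierCoeff (EuclideanSpace.complexify ∘ f) k‖ ^ 2) with hL₀
  set a : ℝ := Real.sqrt (2 * E') with ha
  have hE'1 : 1 ≤ E' := le_max_right _ _
  have hE'0 : 0 < E' := lt_of_lt_of_le one_pos hE'1
  have hEE' : E ≤ E' := le_max_left _ _
  have hL₀0 : 0 ≤ L₀ := Real.sqrt_nonneg _
  have ha0 : 0 ≤ a := Real.sqrt_nonneg _
  have hden : 0 < 2 * E' * L₀ * a + 1 := by positivity
  refine ⟨ε₀ ^ 2 / (2 * E' * L₀ * a + 1), by positivity, ?_⟩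
  intro ν hν hν₁ N U hU hUpl htrap
  -- the trajectory and its budget functions
  have hfG : IsGalerkinMode m f := hf
  have hGT : Torus.IsGalerkinTrajectory ν f N U := Torus.isGalerkinTrajectory_iff.2 hU
  obtain ⟨e, G, Lp, P, Wk, he_c, hG_c, hLp_c, hP_c, hWk_c, he0, hG0, he_d, hG_d, hKE, hwork,
    hPbd, hinterp, hGinit⟩ := exists_planar_budget_functions hfG hGT hUpl
  -- the trap in terms of the budget functions
  have he_le : ∀ τ, 0 ≤ τ → e τ ≤ 2 * E' := fun τ hτ => by
    have h := (htrap τ hτ).1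
    rw [hKE τ hτ] at h
    linarith
  have hWk_ge : ∀ τ, 0 ≤ τ → ε₀ ≤ Wk τ := fun τ hτ => by
    have h := (htrap τ hτ).2
    rwa [hwork τ hτ] at h
  have hP_le : ∀ τ, 0 ≤ τ → -P τ ≤ L₀ * a := fun τ hτ => by
    have h1 : -P τ ≤ |P τ| := neg_le_abs _
    have h2 : Real.sqrt (e τ) ≤ a := Real.sqrt_le_sqrt (he_le τ hτ)
    have h3 := hPbd τ
    have h4 : L₀ * Real.sqrt (e τ) ≤ L₀ * a := mul_le_mul_of_nonneg_left h2 hL₀0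
    linarith
  -- the smallness of `ν`
  have hνB : ν * (2 * E' * L₀ * a + 1) < ε₀ ^ 2 := (lt_div_iff₀ hden).1 hν₁
  -- the choice of `λ` and `T`
  set lam : ℝ := 2 * ν * E' / ε₀ with hlam
  have hlam0 : 0 < lam := by positivity
  set T : ℝ := 2 * ε₀ * E' / ν + E' * G 0 + 1 with hT
  have hG00 : 0 ≤ G 0 := hG0 0
  have hT0 : 0 ≤ T := by positivity
  -- the budget inequality on `[0, T]`
  have hmain := budget_inequality (E := E') (B := L₀ * a) hT0 hlam0 hν.le he_c hG_c hLp_c hP_c hWk_c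
    he0 hG0 (he_d T) (hG_d T) (fun τ hτ => he_le τ hτ.1) (fun τ hτ => hWk_ge τ hτ.1)
    (fun τ hτ => hP_le τ hτ.1) (fun τ => hinterp τ lam hlam0)
  -- evaluate the right-hand side at `λ = 2νE'/ε₀`
  have hx1 : ν * E' * T / lam = ε₀ * T / 2 := by
    rw [hlam]
    field_simp
  have hx2 : lam / 2 * (G 0 / 2 + L₀ * a * T) =
      ν * E' * G 0 / (2 * ε₀) + ν * E' * L₀ * a * T / ε₀ := by
    rw [hlam]
    ring
  have hx3 : ν * E' * L₀ * a * T / ε₀ ≤ ε₀ * T / 2 - ν * T / (2 * ε₀) := by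
    have h1 : ν * E' * L₀ * a ≤ (ε₀ ^ 2 - ν) / 2 := by linarith
    have h2 : ν * E' * L₀ * a * T ≤ (ε₀ ^ 2 - ν) / 2 * T := mul_le_mul_of_nonneg_right h1 hT0
    have h3 : ν * E' * L₀ * a * T / ε₀ ≤ (ε₀ ^ 2 - ν) / 2 * T / ε₀ :=
      div_le_div_of_nonneg_right h2 hε₀.le
    have heq : (ε₀ ^ 2 - ν) / 2 * T / ε₀ = ε₀ * T / 2 - ν * T / (2 * ε₀) := by
      field_simp
    linarith
  rw [hx1, hx2] at hmain
  -- `ν T / (2ε₀) ≤ E' + ν E' G 0 / (2 ε₀)`, i.e. `T ≤ 2ε₀E'/ν + E' G 0`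
  have hfin : ν * T / (2 * ε₀) ≤ E' + ν * E' * G 0 / (2 * ε₀) := by linarith
  have hfin' : T ≤ 2 * ε₀ * E' / ν + E' * G 0 := by
    have h := (div_le_iff₀ (by positivity : (0 : ℝ) < 2 * ε₀)).1 hfin
    have heq : (E' + ν * E' * G 0 / (2 * ε₀)) * (2 * ε₀) = ν * (2 * ε₀ * E' / ν + E' * G 0) := by
      field_simp
    have h2 : ν * T ≤ ν * (2 * ε₀ * E' / ν + E' * G 0) := by linarith
    exact le_of_mul_le_mul_left h2 hν
  have hTdef : T = 2 * ε₀ * E' / ν + E' * G 0 + 1 := hT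
  linarith

end Summit.AnomalousDissipation.AnomalousDissipation.Theorems

end
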